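import Literature.Topology.FourManifolds.SmoothSchoenfliesFiveLeCap
import Literature.Topology.FourManifolds.SmaleHomologySpheresHCobordism
import Literature.Topology.FourManifolds.HomotopySpheresInverseHomotopy
import Literature.Topology.FourManifolds.HCobordantOfDiffeomorph
import Literature.Topology.FourManifolds.ImmersionCriterion
import Literature.Topology.FourManifolds.ImmersionOrientation
import Literature.AlgebraicTopology.Homotopy.StrongDeformationRetractUnion
import Literature.AlgebraicTopology.Homotopy.StrongDeformationRetractTransport
import HarnessLib

/-!
# The ball complement of a closed side of a smooth `Sᵐ ⊆ Sᵐ⁺¹` is an h-cobordism — without Whitehead's theorem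

Topic `Literature/Topology/FourManifolds`, fifth companion of the named fact
`Literature.Topology.FourManifolds.exists_diffeomorph_image_eq_sphereEquator_of_five_le`
(`SliceKnots.lean`; Milnor, *Lectures on the h-cobordism theorem* (1965), §9, Prop. D: the
smooth Schoenflies theorem in dimensions `≥ 5`).  **Everything in this file is proved; no named
fact is introduced.**

Milnor's proof of Prop. D (p. 112; held copy PDF p. 59) applies Prop. A to the closure `D₀` of a
component of `Sⁿ - Σ`, and the proof of Prop. A (p. 109) applies the h-cobordism theorem 9.1 to
`(W - Int D₀; Bd D₀, V)` for a smooth disc `D₀ ⊂ Int W`, after checking that it "satisfies the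
conditions of the h-Cobordism Theorem".  In the tree Thm. 9.1 is the named fact
`isTrivial_of_isHCobordism_of_five_le` (`HCobordism.lean`), whose hypothesis is that both ends of
the cobordism are homotopy equivalences (`Cobordism.IsHCobordism`).  For a GENERAL contractible
`W` this hypothesis is Kervaire–Milnor's Lemma 2.3, which the tree reduces to Whitehead's theorem,
the CW type of compact manifolds and Lefschetz duality (`HomotopySpheresInverseHomotopy.lean`,
named facts).  **For the closed side `W` of a smoothly embedded sphere `Σ = K(Sᵐ) ⊆ Sᵐ⁺¹` this
file proves the hypothesis outright**, by elementary homotopy theory inside the ambient sphere: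

* §1 `PuncturedBall.isStrongDeformationRetractOf_sphere` — the unit sphere is a strong
  deformation retract of the closed unit ball punctured at ANY interior point `p` (push along the
  rays from `p`; the tree had the case `p = 0`, `CellCentreLocalisation.lean`);
* §2 `IsStrongDeformationRetractOf.isHomotopyEquiv_inclusion` — a strong deformation retract
  includes by a homotopy equivalence; §3 `IsHomotopyEquiv.comp`, `IsHomotopyEquiv.of_comp` — the
  two-out-of-three property used below;
* §4 `IsSidePackage.isStrongDeformationRetractOf_diff_singleton` — **the hypersurface `Z` is a
  strong deformation retract of a closed side punctured at an interior point** (Brown's theorem,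
  `IsSidePackage.nonempty_homeomorph_regularSublevel`: the side is a cell; invariance of the
  boundary under homeomorphisms, `mem_boundary_iff_homeomorph_apply_mem`; and §1);
* §5 `SphereEmbedding.isHomotopyEquiv_cobInl` — for ball-removal data `i : ℝᵐ⁺¹ → Int W` on the
  side `W = {g ≤ 0}` (`BallRemovalCobordism.lean`), **the end `∂W → K ≅ W ∖ i(B)` is a homotopy
  equivalence**: `∂W ↪ W ∖ {i 0}` is one by §4, `K → W ∖ {i 0}` is one by the radial deformation
  (`ComplBallHomotopyEquiv.lean`, `BallRemovalData.toComplCenter`), and two-out-of-three;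
* §6 `SphereEmbedding.isHomotopyEquiv_cobInr` — **the seam end `Sᵐ → K` is a homotopy
  equivalence**: in `Sᵐ⁺¹` the complement `C₁` of the removed open ball `ι(B)` (`ι = incl ∘ i`, a
  smooth embedding `ℝᵐ⁺¹ → Sᵐ⁺¹` by the chain rule and the immersion criterion) is a smoothly
  embedded closed ball with boundary `ι(Sᵐ)` (Palais, `hasComplementBall_of_isSmoothEmbedding`),
  so `ι(Sᵐ)` is a strong deformation retract of `C₁` punctured at a point `q'` of the OTHER open
  side; so is `W ∖ ι(B)`, by pasting the deformation of the other closed side punctured at `q'`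
  onto `Z` (§4 for `-g`, `IsStrongDeformationRetractOf.union_of_inter_subset`) — two-out-of-three
  again, and transport back into `W` along the embedding `W ↪ Sᵐ⁺¹`;
* §7 `SphereEmbedding.isHCobordism_ballRemoval`, `….simplyConnectedSpace_ballRemoval_K` — the
  cobordism `(K; Sᵐ, ∂W)` is a simply connected h-cobordism.

The sequel `SmoothSchoenfliesFiveLeHCobordism.lean` feeds this to Thm. 9.1 and to the smooth
filling theorem (`SmoothSchoenfliesFiveLeFill.lean`) to obtain `W ≅ 𝔻ᵐ⁺¹`, hence Prop. D, for
`m + 1 ≥ 6` from Thm. 9.1 alone.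

## References

* J. Milnor, *Lectures on the h-cobordism theorem*, Princeton (1965), §9: proof of Prop. A
  (p. 109; PDF p. 58), Prop. D (p. 112; PDF p. 59). [MilnorHCobordism1965]
* M. Kervaire, J. Milnor, *Groups of homotopy spheres I*, Ann. of Math. 77 (1963), Lemma 2.3 and
  its proof (pp. 506–507). [KervaireMilnorAnnals1963]
* A. Hatcher, *Algebraic Topology*, CUP (2002), Ch. 0 (deformation retractions, p. 2; Cor. 0.21:
  two-out-of-three). [HatcherAT2002]
* R. J. Daverman, *Decompositions of manifolds* (1986), Thm. II.6.6 (Brown). [Daverman1986]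
-/

open scoped Manifold ContDiff Topology ContinuousMap RealInnerProductSpace
open Set Function Metric Module
open Literature.AlgebraicTopology.Homotopy

noncomputable section

namespace Literature.Topology.FourManifolds

/-- Local notation: `𝔼 n` is the model Euclidean space `EuclideanSpace ℝ (Fin n)`. -/
local notation "𝔼 " n:arg => EuclideanSpace ℝ (Fin n)
/-- Local notation: `𝕊 n` is the unit sphere in `EuclideanSpace ℝ (Fin (n + 1))`. -/
local notation "𝕊 " n:arg => (Metric.sphere (0 : EuclideanSpace ℝ (Fin (n + 1))) 1)
/-- Local notation: `𝔻 n` is the closed unit ball in `EuclideanSpace ℝ (Fin n)`. -/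
local notation "𝔻 " n:arg => (Metric.closedBall (0 : EuclideanSpace ℝ (Fin n)) 1)

/-! ### §1 The sphere is a strong deformation retract of the ball punctured at an interior point -/

namespace PuncturedBall

variable {F : Type*} [NormedAddCommGroup F] [InnerProductSpace ℝ F]

/-- The exit parameter `μ ≥ 1` of the ray from `p` through `x`: the larger root of
`‖p + μ (x - p)‖ = 1`, namely `(-b + √(b² - a c))/a` with `a = ‖x - p‖²`, `b = ⟪p, x - p⟫`,
`c = ‖p‖² - 1`. [folklore] -/
def exitCoeff (p x : F) : ℝ :=
  (-⟪p, x - p⟫ + Real.sqrt (⟪p, x - p⟫ ^ 2 - ‖x - p‖ ^ 2 * (‖p‖ ^ 2 - 1))) / ‖x - p‖ ^ 2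

/-- The exit point `p + μ (x - p)` of the ray from `p` through `x` on the unit sphere. [folklore] -/
def exitPoint (p x : F) : F := p + exitCoeff p x • (x - p)

/-- The deformation `x ↦ x + t (μ - 1) (x - p) = (1 - t) x + t (exit point)`. [folklore] -/
def deform (p : F) (t : ℝ) (x : F) : F := x + (t * (exitCoeff p x - 1)) • (x - p)

section Free

variable {p : F}

/-- The deformation as a convex combination: `(1 - t) x + t (exit point)`. [folklore] -/
theorem deform_eq (t : ℝ) (x : F) : deform p t x = (1 - t) • x + t • exitPoint p x := by
  unfold deform exitPoint
  module

/-- The deformation relative to `p`: `deform t x - p = (1 + t (μ - 1)) (x - p)`. [folklore] -/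
theorem deform_sub (t : ℝ) (x : F) :
    deform p t x - p = (1 + t * (exitCoeff p x - 1)) • (x - p) := by
  unfold deform
  module

/-- The exit parameter is continuous off `p`. [folklore] -/
theorem continuousOn_exitCoeff : ContinuousOn (exitCoeff p) {x | x ≠ p} := by
  have hd : Continuous fun x : F => x - p := continuous_id.sub continuous_const
  have hb : Continuous fun x : F => ⟪p, x - p⟫ := continuous_const.inner hd
  have ha : Continuous fun x : F => ‖x - p‖ ^ 2 := (continuous_norm.comp hd).pow 2
  refine ContinuousOn.div ?_ ha.continuousOn fun x hx => ?_
  · exact (hb.neg.add (Real.continuous_sqrt.comp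
      ((hb.pow 2).sub (ha.mul continuous_const)))).continuousOn
  · exact (pow_pos (norm_pos_iff.2 (sub_ne_zero.2 hx)) 2).ne'

/-- The deformation is continuous on `ℝ × {x ≠ p}`. [folklore] -/
theorem continuousOn_deform :
    ContinuousOn (fun q : ℝ × F => deform p q.1 q.2) (univ ×ˢ {x | x ≠ p}) := by
  have h1 : ContinuousOn (fun q : ℝ × F => exitCoeff p q.2) (univ ×ˢ {x | x ≠ p}) :=
    continuousOn_exitCoeff.comp continuousOn_snd fun q hq => hq.2
  have h2 : ContinuousOn (fun q : ℝ × F => q.1 * (exitCoeff p q.2 - 1)) (univ ×ˢ {x | x ≠ p}) :=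
    continuousOn_fst.mul (h1.sub continuousOn_const)
  exact continuousOn_snd.add (h2.smul (continuousOn_snd.sub continuousOn_const))

end Free

variable {p : F} (hp : ‖p‖ < 1)
include hp

/-- The quadratic relation `a μ² + 2 b μ + c = 0` of the exit parameter. [folklore] -/
theorem quadratic_exitCoeff {x : F} (hx : x ≠ p) :
    ‖x - p‖ ^ 2 * exitCoeff p x ^ 2 + 2 * ⟪p, x - p⟫ * exitCoeff p x + (‖p‖ ^ 2 - 1) = 0 := by
  set a := ‖x - p‖ ^ 2 with ha
  set b := ⟪p, x - p⟫ with hb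
  set c := ‖p‖ ^ 2 - 1 with hc
  have ha0 : 0 < a := by rw [ha]; exact pow_pos (norm_pos_iff.2 (sub_ne_zero.2 hx)) 2
  have hc0 : c < 0 := by rw [hc]; nlinarith [norm_nonneg p]
  have hdisc : 0 ≤ b ^ 2 - a * c := by nlinarith
  set s := Real.sqrt (b ^ 2 - a * c) with hs
  have hs2 : s ^ 2 = b ^ 2 - a * c := by rw [hs]; exact Real.sq_sqrt hdisc
  have hμ : exitCoeff p x = (-b + s) / a := rfl
  rw [hμ]
  have key : (-b + s) ^ 2 + 2 * b * (-b + s) + a * c = 0 := by linear_combination hs2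
  have : a * ((-b + s) / a) ^ 2 + 2 * b * ((-b + s) / a) + c =
      ((-b + s) ^ 2 + 2 * b * (-b + s) + a * c) / a := by
    field_simp
  rw [this, key, zero_div]

/-- The exit point lies on the unit sphere. [folklore] -/
theorem norm_exitPoint {x : F} (hx : x ≠ p) : ‖exitPoint p x‖ = 1 := by
  have h := quadratic_exitCoeff hp hx
  have hsq : ‖exitPoint p x‖ ^ 2 = 1 := by
    rw [exitPoint, norm_add_sq_real, real_inner_smul_right, norm_smul, mul_pow, Real.norm_eq_abs,
      sq_abs]
    linear_combination h
  have h1 : (‖exitPoint p x‖ - 1) * (‖exitPoint p x‖ + 1) = 0 := by ring_nf; linarith [hsq]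
  rcases mul_eq_zero.1 h1 with h2 | h2
  · linarith
  · linarith [norm_nonneg (exitPoint p x)]

/-- On the closed ball the exit parameter is `≥ 1` (the ray leaves the ball beyond `x`).
[folklore] -/
theorem one_le_exitCoeff {x : F} (hx : x ≠ p) (hx1 : ‖x‖ ≤ 1) : 1 ≤ exitCoeff p x := by
  set a := ‖x - p‖ ^ 2 with ha
  set b := ⟪p, x - p⟫ with hb
  set c := ‖p‖ ^ 2 - 1 with hc
  have ha0 : 0 < a := by rw [ha]; exact pow_pos (norm_pos_iff.2 (sub_ne_zero.2 hx)) 2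
  have hc0 : c < 0 := by rw [hc]; nlinarith [norm_nonneg p]
  have hdisc : 0 ≤ b ^ 2 - a * c := by nlinarith
  -- `a + 2 b + c = ‖x‖² - 1 ≤ 0`
  have hsum : a + 2 * b + c ≤ 0 := by
    have hx' : ‖x‖ ^ 2 = ‖p‖ ^ 2 + 2 * b + a := by
      have : x = p + (x - p) := by abel
      conv_lhs => rw [this]
      rw [norm_add_sq_real]
    nlinarith [norm_nonneg x]
  have hμ : exitCoeff p x = (-b + Real.sqrt (b ^ 2 - a * c)) / a := rfl
  rw [hμ, le_div_iff₀ ha0, one_mul]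
  have hs : a + b ≤ Real.sqrt (b ^ 2 - a * c) := by
    by_cases hab : a + b ≤ 0
    · exact hab.trans (Real.sqrt_nonneg _)
    · rw [Real.le_sqrt' (not_le.1 hab)]
      nlinarith
  linarith

/-- On the unit sphere the exit parameter is `1` (the exit point of `x` is `x`). [folklore] -/
theorem exitCoeff_eq_one {x : F} (hx1 : ‖x‖ = 1) : exitCoeff p x = 1 := by
  have hx : x ≠ p := by rintro rfl; exact absurd hx1 hp.ne
  set a := ‖x - p‖ ^ 2 with ha
  set b := ⟪p, x - p⟫ with hb
  set c := ‖p‖ ^ 2 - 1 with hc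
  have ha0 : 0 < a := by rw [ha]; exact pow_pos (norm_pos_iff.2 (sub_ne_zero.2 hx)) 2
  -- `a + 2 b + c = 0` and `a + b = 1 - ⟪x, p⟫ > 0`
  have hsum : a + 2 * b + c = 0 := by
    have hx' : ‖x‖ ^ 2 = ‖p‖ ^ 2 + 2 * b + a := by
      have : x = p + (x - p) := by abel
      conv_lhs => rw [this]
      rw [norm_add_sq_real]
    rw [hx1] at hx'
    linarith
  have hab : 0 < a + b := by
    have h1 : a + b = ⟪x, x - p⟫ := by
      rw [ha, hb, ← real_inner_self_eq_norm_sq, ← inner_add_left, sub_add_cancel]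
    have h2 : ⟪x, x - p⟫ = ‖x‖ ^ 2 - ⟪x, p⟫ := by
      rw [inner_sub_right, real_inner_self_eq_norm_sq]
    have h3 : ⟪x, p⟫ ≤ ‖x‖ * ‖p‖ := real_inner_le_norm x p
    rw [h1, h2, hx1]
    nlinarith
  have hdisc : b ^ 2 - a * c = (a + b) ^ 2 := by
    have : c = -(a + 2 * b) := by linarith
    rw [this]; ring
  have hμ : exitCoeff p x = (-b + Real.sqrt (b ^ 2 - a * c)) / a := rfl
  rw [hμ, hdisc, Real.sqrt_sq hab.le]
  field_simp
  ring

/-- **The unit sphere is a strong deformation retract of the closed unit ball punctured at an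
interior point `p`** (push along the rays issuing from `p`; for `p = 0` this is the radial
deformation of Hatcher, *Algebraic Topology* (2002), Ch. 0, p. 2 and Example 2.17).
[cite: HatcherAT2002, Ch. 0, p. 2] -/
theorem isStrongDeformationRetractOf_sphere :
    IsStrongDeformationRetractOf (sphere (0 : F) 1) (closedBall (0 : F) 1 \ {p}) := by
  have hS : ∀ x : F, x ∈ closedBall (0 : F) 1 \ {p} → ‖x‖ ≤ 1 ∧ x ≠ p := fun x hx =>
    ⟨mem_closedBall_zero_iff.1 hx.1, hx.2⟩
  refine IsStrongDeformationRetractOf.of_continuousOn (deform p)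
    (continuousOn_deform.mono (prod_mono (subset_univ _) fun x hx => (hS x hx).2))
    (fun t ht x hx => ?_) (fun x _ => ?_) (fun x hx => ?_) (fun t _ x _ hxA => ?_)
  · obtain ⟨hx1, hxp⟩ := hS x hx
    have hμ := one_le_exitCoeff hp hxp hx1
    constructor
    · rw [mem_closedBall_zero_iff, deform_eq]
      calc ‖(1 - t) • x + t • exitPoint p x‖ ≤ ‖(1 - t) • x‖ + ‖t • exitPoint p x‖ := norm_add_le _ _
        _ = (1 - t) * ‖x‖ + t * ‖exitPoint p x‖ := by
          rw [norm_smul_of_nonneg (by linarith [ht.2]), norm_smul_of_nonneg ht.1]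
        _ ≤ (1 - t) * 1 + t * 1 := by
          rw [norm_exitPoint hp hxp]
          nlinarith [ht.1, ht.2]
        _ = 1 := by ring
    · intro h
      have h' : deform p t x - p = 0 := by rw [mem_singleton_iff.1 h, sub_self]
      rw [deform_sub, smul_eq_zero] at h'
      rcases h' with h' | h'
      · nlinarith [ht.1]
      · exact hxp (sub_eq_zero.1 h')
  · simp [deform]
  · obtain ⟨-, hxp⟩ := hS x hx
    have : deform p 1 x = exitPoint p x := by
      rw [deform_eq]; simp
    rw [this, mem_sphere_zero_iff_norm]
    exact norm_exitPoint hp hxp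
  · rw [deform, exitCoeff_eq_one hp (mem_sphere_zero_iff_norm.1 hxA)]
    simp

end PuncturedBall

/-! ### §2 A strong deformation retract includes by a homotopy equivalence -/

/-- **The inclusion of a strong deformation retract is a homotopy equivalence** (tree predicate
`IsHomotopyEquiv`): the end of the deformation is a homotopy inverse, strictly left inverse to
the inclusion and right inverse up to the deformation itself (Hatcher 2002, Ch. 0, p. 3).
[cite: HatcherAT2002, Ch. 0, p. 3] -/
theorem _root_.Literature.AlgebraicTopology.Homotopy.IsStrongDeformationRetractOf.isHomotopyEquiv_inclusion
    {X : Type*} [TopologicalSpace X] {A S : Set X} (h : IsStrongDeformationRetractOf A S)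
    (hAS : A ⊆ S) : IsHomotopyEquiv (Set.inclusion hAS) := by
  obtain ⟨H, h0, h1, hfix⟩ := h
  let ι : C(A, S) := ⟨Set.inclusion hAS, continuous_inclusion hAS⟩
  let r : C(S, A) := ⟨fun x => ⟨(H (1, x) : X), h1 x⟩,
    (continuous_subtype_val.comp (H.continuous.comp (Continuous.prodMk_right 1))).subtype_mk _⟩
  have hrι : r.comp ι = ContinuousMap.id A := by
    ext a : 1
    apply Subtype.ext
    show (H (1, ι a) : X) = a
    rw [hfix 1 (ι a) a.2]
    rfl
  have hιr : ∀ x : S, ι (r x) = H (1, x) := fun x => Subtype.ext rfl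
  let G : ContinuousMap.Homotopy (ContinuousMap.id S) (ι.comp r) :=
    { toFun := fun q => H (q.1, q.2)
      continuous_toFun := H.continuous.comp (continuous_fst.prodMk continuous_snd)
      map_zero_left := fun x => h0 x
      map_one_left := fun x => (hιr x).symm }
  have hleft : (r.comp ι).Homotopic (ContinuousMap.id A) := by
    rw [hrι]
  have hright : (ι.comp r).Homotopic (ContinuousMap.id S) := ⟨G.symm⟩
  let e : A ≃ₕ S := ⟨ι, r, hleft, hright⟩
  exact ⟨e, rfl⟩

/-! ### §3 Two out of three for homotopy equivalences -/

section TwoOutOfThree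

variable {X Y Z : Type*} [TopologicalSpace X] [TopologicalSpace Y] [TopologicalSpace Z]

/-- The composite of two homotopy equivalences is a homotopy equivalence. [folklore] -/
theorem IsHomotopyEquiv.comp {g : Y → Z} {f : X → Y} (hg : IsHomotopyEquiv g)
    (hf : IsHomotopyEquiv f) : IsHomotopyEquiv (g ∘ f) := by
  obtain ⟨eg, rfl⟩ := hg
  obtain ⟨ef, rfl⟩ := hf
  exact ⟨ef.trans eg, rfl⟩

/-- **Two out of three**: if `g` and `g ∘ f` are homotopy equivalences and `f` is continuous,
then `f` is a homotopy equivalence (a homotopy inverse is `(g ∘ f)⁻¹ ∘ g`; Hatcher 2002, Ch. 0,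
Cor. 0.21 and Exercise 10). [cite: HatcherAT2002, Ch. 0, Cor. 0.21] -/
theorem IsHomotopyEquiv.of_comp {g : Y → Z} {f : X → Y} (hf : Continuous f)
    (hg : IsHomotopyEquiv g) (hgf : IsHomotopyEquiv (g ∘ f)) : IsHomotopyEquiv f := by
  obtain ⟨eg, heg⟩ := hg
  obtain ⟨egf, hegf⟩ := hgf
  let fC : C(X, Y) := ⟨f, hf⟩
  have hgff : eg.toFun.comp fC = egf.toFun := by
    ext x : 1
    show eg.toFun (f x) = egf.toFun x
    rw [heg, hegf]
    rfl
  let F' : C(Y, X) := egf.invFun.comp eg.toFun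
  have hleft : (F'.comp fC).Homotopic (ContinuousMap.id X) := by
    have : F'.comp fC = egf.invFun.comp egf.toFun := by
      rw [← hgff]; rfl
    rw [this]
    exact egf.left_inv
  have hright : (fC.comp F').Homotopic (ContinuousMap.id Y) := by
    -- `f ∘ F' ≃ (g⁻¹ ∘ g) ∘ f ∘ F' = g⁻¹ ∘ ((g ∘ f) ∘ (g ∘ f)⁻¹) ∘ g ≃ g⁻¹ ∘ g ≃ id`
    have h1 : (fC.comp F').Homotopic ((eg.invFun.comp eg.toFun).comp (fC.comp F')) := by
      have := ContinuousMap.Homotopic.comp (ContinuousMap.Homotopic.symm eg.left_inv)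
        (ContinuousMap.Homotopic.refl (fC.comp F'))
      simpa using this
    have h2 : (eg.invFun.comp eg.toFun).comp (fC.comp F') =
        eg.invFun.comp ((egf.toFun.comp egf.invFun).comp eg.toFun) := by
      rw [← hgff]; rfl
    have h3 : (eg.invFun.comp ((egf.toFun.comp egf.invFun).comp eg.toFun)).Homotopic
        (eg.invFun.comp ((ContinuousMap.id Z).comp eg.toFun)) :=
      ContinuousMap.Homotopic.comp (ContinuousMap.Homotopic.refl eg.invFun)
        (ContinuousMap.Homotopic.comp egf.right_inv (ContinuousMap.Homotopic.refl eg.toFun))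
    have h4 : eg.invFun.comp ((ContinuousMap.id Z).comp eg.toFun) = eg.invFun.comp eg.toFun := rfl
    exact ContinuousMap.Homotopic.trans (ContinuousMap.Homotopic.trans h1 (h2 ▸ h3)) (h4 ▸ eg.left_inv)
  exact ⟨{ toFun := fC, invFun := F', left_inv := hleft, right_inv := hright }, rfl⟩

end TwoOutOfThree

/-- **Subsets correspond homeomorphically under an embedding**: `A ≅ e(A)`. [folklore] -/
def embImageHomeomorph {X Y : Type*} [TopologicalSpace X] [TopologicalSpace Y] {e : X → Y}
    (he : Topology.IsEmbedding e) (A : Set X) : A ≃ₜ ↥(e '' A) :=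
  (he.comp Topology.IsEmbedding.subtypeVal).toHomeomorph.trans
    (Homeomorph.setCongr (image_eq_range e A).symm)

/-- The value of `embImageHomeomorph`. [folklore] -/
@[simp] theorem coe_embImageHomeomorph {X Y : Type*} [TopologicalSpace X] [TopologicalSpace Y]
    {e : X → Y} (he : Topology.IsEmbedding e) (A : Set X) (a : A) :
    (embImageHomeomorph he A a : Y) = e a := rfl

attribute [local instance] fact_finrank_euclideanSpace_succ

/-! ### §4 The hypersurface is a strong deformation retract of a punctured closed side -/

namespace SphereHypersurfaceSides.IsSidePackage

variable {m : ℕ} {Z : Set (𝕊 (m + 1))} {g : (𝕊 (m + 1)) → ℝ}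

/-- Membership in the hypersurface of a side package: `z ∈ Z ↔ g z = 0`. [folklore] -/
theorem mem_iff_eq_zero (hg : IsSidePackage Z g) (z : 𝕊 (m + 1)) : z ∈ Z ↔ g z = 0 :=
  (Set.ext_iff.1 hg.preimage_zero z).symm

/-- **The hypersurface `Z` is a strong deformation retract of the closed side `{g ≤ 0}`
punctured at any interior point `q` (`g q < 0`)**: by Brown's theorem the closed side is a cell
(`nonempty_homeomorph_regularSublevel`), its boundary `Z` going onto `∂𝔻ᵐ⁺¹` and `q` to an interior
point by invariance of the boundary (`mem_boundary_iff_homeomorph_apply_mem`), and the sphere is a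
strong deformation retract of the punctured disc (`PuncturedBall.isStrongDeformationRetractOf_sphere`).
[cite: Daverman1986, Thm. II.6.6 (PDF p. 40)] [cite: HatcherAT2002, Ch. 0, p. 2] -/
theorem isStrongDeformationRetractOf_diff_singleton (hg : IsSidePackage Z g) {q : 𝕊 (m + 1)}
    (hq : g q < 0) : IsStrongDeformationRetractOf Z ({z | g z ≤ 0} \ {q}) := by
  obtain ⟨β⟩ := hg.nonempty_homeomorph_regularSublevel
  have hreg := hg.isRegularLevel
  -- boundary and interior under the homeomorphism
  have hbd : ∀ w : RegularSublevel hreg,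
      g (RegularSublevel.incl hreg w) = 0 ↔ ‖(β w : 𝔼 (m + 1))‖ = 1 := by
    intro w
    rw [← RegularSublevel.mem_boundary_iff hreg w, mem_boundary_iff_homeomorph_apply_mem β w,
      boundary_closedBall]
    rfl
  set w₀ : RegularSublevel hreg := RegularSublevel.mk hreg q hq.le with hw₀
  set p₀ : 𝔻 (m + 1) := β w₀ with hp₀
  have hp₀1 : ‖(p₀ : 𝔼 (m + 1))‖ < 1 := by
    refine lt_of_le_of_ne (mem_closedBall_zero_iff.1 p₀.2) fun h => ?_
    have : g (RegularSublevel.incl hreg w₀) = 0 := (hbd w₀).2 h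
    rw [hw₀, RegularSublevel.incl_mk] at this
    exact absurd this hq.ne
  have hZ := hg.mem_iff_eq_zero
  -- the deformation of the punctured disc, moved to the sphere
  have h1 := PuncturedBall.isStrongDeformationRetractOf_sphere hp₀1
  have h2 := h1.preimage_val (W := closedBall (0 : 𝔼 (m + 1)) 1) sdiff_subset
  set f : (𝔻 (m + 1)) → 𝕊 (m + 1) := fun y => RegularSublevel.incl hreg (β.symm y) with hf
  have hfe : Topology.IsEmbedding f :=
    (RegularSublevel.isEmbedding_incl hreg).comp β.symm.isEmbedding
  have h3 := h2.image_of_isEmbedding hfe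
  have e1 : f '' (Subtype.val ⁻¹' sphere (0 : 𝔼 (m + 1)) 1) = Z := by
    ext z
    constructor
    · rintro ⟨y, hy, rfl⟩
      have hy' : ‖(y : 𝔼 (m + 1))‖ = 1 := mem_sphere_zero_iff_norm.1 hy
      rw [hZ]
      apply (hbd (β.symm y)).2
      rw [Homeomorph.apply_symm_apply]; exact hy'
    · intro hz
      have hz0 : g z = 0 := (hZ z).1 hz
      refine ⟨β (RegularSublevel.mk hreg z hz0.le), ?_, ?_⟩
      · show (β (RegularSublevel.mk hreg z hz0.le) : 𝔼 (m + 1)) ∈ sphere (0 : 𝔼 (m + 1)) 1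
        rw [mem_sphere_zero_iff_norm]
        exact (hbd _).1 (by rw [RegularSublevel.incl_mk]; exact hz0)
      · simp only [hf, Homeomorph.symm_apply_apply, RegularSublevel.incl_mk]
  have e2 : f '' (Subtype.val ⁻¹' (closedBall (0 : 𝔼 (m + 1)) 1 \ {(p₀ : 𝔼 (m + 1))})) =
      {z | g z ≤ 0} \ {q} := by
    ext z
    constructor
    · rintro ⟨y, hy, rfl⟩
      have hy' : (y : 𝔼 (m + 1)) ≠ p₀ := hy.2
      refine ⟨RegularSublevel.apply_incl_le hreg _, fun h => hy' ?_⟩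
      have h1 : f y = q := mem_singleton_iff.1 h
      have h' : β.symm y = w₀ := by
        apply RegularSublevel.injective_incl hreg
        show f y = RegularSublevel.incl hreg w₀
        rw [h1, hw₀, RegularSublevel.incl_mk]
      rw [hp₀, ← h', Homeomorph.apply_symm_apply]
    · rintro ⟨hz, hzq⟩
      refine ⟨β (RegularSublevel.mk hreg z hz), ⟨(β _).2, fun h => hzq ?_⟩, ?_⟩
      · have h' : β (RegularSublevel.mk hreg z hz) = p₀ := Subtype.ext h
        rw [hp₀] at h'
        have := congrArg (RegularSublevel.incl hreg) (β.injective h')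
        rw [hw₀, RegularSublevel.incl_mk, RegularSublevel.incl_mk] at this
        exact this
      · simp only [hf, Homeomorph.symm_apply_apply, RegularSublevel.incl_mk]
  rw [e1, e2] at h3
  exact h3

end SphereHypersurfaceSides.IsSidePackage

/-! ### §5 The boundary end of the ball-removal cobordism of a closed side -/

namespace SphereHypersurfaceSides.IsSidePackage

variable {m : ℕ} {Z : Set (𝕊 (m + 1))} {g : (𝕊 (m + 1)) → ℝ}

/-- **The closed side `W = {g ≤ 0}` as a null-cobordism of its boundary `∂W`**
(`SmaleHomologySpheres.nullCobordismOfBoundary`), abbreviated. [folklore] -/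
abbrev sideCob (hg : IsSidePackage Z g) :
    NullCobordism m ↥((𝓡∂ (m + 1)).boundary (RegularSublevel hg.isRegularLevel)) :=
  SmaleHomologySpheres.nullCobordismOfBoundary m (RegularSublevel hg.isRegularLevel)

variable (hg : IsSidePackage Z g) (D : BallRemovalData m hg.sideCob.W)

/-- The centre of the removed ball is an interior point: `g < 0` on the removed disc. [folklore] -/
theorem apply_i_lt (v : 𝔼 (m + 1)) : g (RegularSublevel.incl hg.isRegularLevel (D.i v)) < 0 :=
  (RegularSublevel.isInteriorPoint_iff hg.isRegularLevel (D.i v)).1 (D.isInteriorPoint_i v)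

/-- **The boundary `∂W` is a strong deformation retract of the side `W = {g ≤ 0}` punctured at the
centre of the removed ball** (§4 restricted to the subspace `W`). [cite: HatcherAT2002, Ch. 0, p. 2] -/
theorem isStrongDeformationRetractOf_boundary :
    IsStrongDeformationRetractOf (X := hg.sideCob.W)
      ((𝓡∂ (m + 1)).boundary hg.sideCob.W) {D.i 0}ᶜ := by
  have h := (hg.isStrongDeformationRetractOf_diff_singleton (hg.apply_i_lt D 0)).preimage_val
    (W := g ⁻¹' Iic 0) (fun z hz => hz.1)
  have hZ := hg.mem_iff_eq_zero
  have e1 : (Subtype.val ⁻¹' Z : Set ↥(g ⁻¹' Iic 0)) =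
      (𝓡∂ (m + 1)).boundary (RegularSublevel hg.isRegularLevel) := by
    ext w
    show (w : 𝕊 (m + 1)) ∈ Z ↔ w ∈ (𝓡∂ (m + 1)).boundary (RegularSublevel hg.isRegularLevel)
    exact (hZ _).trans (RegularSublevel.mem_boundary_iff hg.isRegularLevel w).symm
  have e2 : (Subtype.val ⁻¹' ({z | g z ≤ 0} \ {RegularSublevel.incl hg.isRegularLevel (D.i 0)}) :
      Set ↥(g ⁻¹' Iic 0)) = ({D.i 0}ᶜ : Set (RegularSublevel hg.isRegularLevel)) := by
    ext w
    show (g (w : 𝕊 (m + 1)) ≤ 0 ∧ ¬ ((w : 𝕊 (m + 1)) ∈ ({RegularSublevel.incl hg.isRegularLevel (D.i 0)} :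
      Set (𝕊 (m + 1))))) ↔ ¬ (w ∈ ({D.i 0} : Set (RegularSublevel hg.isRegularLevel)))
    simp only [mem_singleton_iff]
    constructor
    · intro h h'
      exact h.2 (by rw [h']; rfl)
    · intro h
      exact ⟨RegularSublevel.apply_incl_le hg.isRegularLevel w, fun h' =>
        h (RegularSublevel.injective_incl hg.isRegularLevel h')⟩
  rw [e1, e2] at h
  exact h

/-- The boundary misses the centre of the removed ball. [folklore] -/
theorem boundary_subset_compl :
    (𝓡∂ (m + 1)).boundary hg.sideCob.W ⊆ {D.i 0}ᶜ := by
  intro w hw h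
  have h' : w = D.i 0 := h
  exact D.not_isBoundaryPoint_i 0 (h' ▸ hw)

/-- The comparison map `K → W ∖ {i 0}` is a homotopy equivalence (radial deformation,
`BallRemovalData.homotopyEquivComplCenter`). [folklore] -/
theorem isHomotopyEquiv_toComplCenter : IsHomotopyEquiv (D.toComplCenter hg.sideCob) :=
  ⟨D.homotopyEquivComplCenter _, rfl⟩

/-- **The boundary end `∂W → K` of the ball-removal cobordism of a closed side is a homotopy
equivalence**: composed with the comparison map `K → W ∖ {i 0}` (a homotopy equivalence) it is the
inclusion `∂W ↪ W ∖ {i 0}` of a strong deformation retract; two out of three. This is the half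
"the inclusion `M → W` also induces isomorphisms … this completes the proof" of Kervaire–Milnor's
Lemma 2.3 (p. 507), here without duality or Whitehead's theorem.
[cite: KervaireMilnorAnnals1963, Lemma 2.3, proof (pp. 506–507)] [cite: MilnorHCobordism1965, §9, proof of Prop. A (p. 109; PDF p. 58)] -/
theorem isHomotopyEquiv_cobInl : IsHomotopyEquiv (D.cobInl hg.sideCob) := by
  have hincl := (hg.isStrongDeformationRetractOf_boundary D).isHomotopyEquiv_inclusion
    (hg.boundary_subset_compl D)
  have hcomp : (D.toComplCenter hg.sideCob) ∘ (D.cobInl hg.sideCob) =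
      Set.inclusion (hg.boundary_subset_compl D) := by
    funext x
    have h := congrArg (fun F : C(_, _) => F x) (D.toComplCenter_comp_cobInlCM hg.sideCob)
    simp only [ContinuousMap.comp_apply, BallRemovalData.coe_cobInlCM] at h
    rw [comp_apply, h]
    rfl
  refine IsHomotopyEquiv.of_comp (D.isSmoothEmbedding_cobInl hg.sideCob).isEmbedding.continuous
    (hg.isHomotopyEquiv_toComplCenter D) ?_
  rw [hcomp]
  exact hincl

/-! ### §6 The seam end of the ball-removal cobordism of a closed side -/

/-- **The removed disc read in the ambient sphere**: `ι = incl ∘ i : ℝᵐ⁺¹ → Sᵐ⁺¹`. [folklore] -/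
def ambDisc : 𝔼 (m + 1) → 𝕊 (m + 1) := RegularSublevel.incl hg.isRegularLevel ∘ D.i

/-- The value of the ambient disc. [folklore] -/
theorem ambDisc_apply (v : 𝔼 (m + 1)) :
    hg.ambDisc D v = RegularSublevel.incl hg.isRegularLevel (D.i v) := rfl

/-- The ambient disc lies in the open side `{g < 0}`. [folklore] -/
theorem apply_ambDisc_lt (v : 𝔼 (m + 1)) : g (hg.ambDisc D v) < 0 := hg.apply_i_lt D v

/-- The ambient disc is injective. [folklore] -/
theorem injective_ambDisc : Injective (hg.ambDisc D) :=
  (RegularSublevel.injective_incl hg.isRegularLevel).comp D.injective_i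

/-- **The ambient disc is a smooth embedding `ℝᵐ⁺¹ → Sᵐ⁺¹`**: smooth and a topological embedding
as a composite of such, with injective differential by the chain rule (both factors are
immersions), hence an immersion by the immersion criterion for boundaryless manifolds
(`isImmersion_of_injective_mfderiv`; Lee 2013, Thm. 4.12 / Prop. 5.22). [cite: LeeSmoothManifolds2013, Ch. 4 Thm. 4.12] -/
theorem isSmoothEmbedding_ambDisc :
    Manifold.IsSmoothEmbedding (𝓡 (m + 1)) (𝓡 (m + 1)) ∞ (hg.ambDisc D) := by
  have hincl := RegularSublevel.isSmoothEmbedding_incl hg.isRegularLevel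
  have hc : ContMDiff (𝓡 (m + 1)) (𝓡 (m + 1)) ∞ (hg.ambDisc D) :=
    (RegularSublevel.contMDiff_incl hg.isRegularLevel).comp D.contMDiff_i
  have hd : ∀ v, Injective (mfderiv (𝓡 (m + 1)) (𝓡 (m + 1)) (hg.ambDisc D) v) := by
    intro v
    have h1 : MDifferentiableAt (𝓡 (m + 1)) (𝓡∂ (m + 1)) D.i v :=
      (D.contMDiff_i v).mdifferentiableAt (by simp)
    have h2 : MDifferentiableAt (𝓡∂ (m + 1)) (𝓡 (m + 1))
        (RegularSublevel.incl hg.isRegularLevel) (D.i v) :=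
      (RegularSublevel.contMDiff_incl hg.isRegularLevel (D.i v)).mdifferentiableAt (by simp)
    rw [ambDisc, mfderiv_comp v h2 h1]
    exact (injective_mfderiv_of_isImmersionAt' (hincl.isImmersion.isImmersionAt _)).comp
      (injective_mfderiv_of_isImmersionAt' (D.isSmoothEmbedding_i.isImmersion.isImmersionAt v))
  exact ⟨isImmersion_of_injective_mfderiv hc (by exact_mod_cast le_top) hd,
    (RegularSublevel.isEmbedding_incl hg.isRegularLevel).comp D.isOpenEmbedding_i.isEmbedding⟩

/-- **Images of open sets under the ambient disc are open** in `Sᵐ⁺¹`: an open subset `O` of the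
side `W` lying in the open side `{g < 0}` is open in the sphere (it is `V ∩ {g < 0}` for the open
`V` inducing it). [folklore] -/
theorem isOpen_image_ambDisc {s : Set (𝔼 (m + 1))} (hs : IsOpen s) : IsOpen (hg.ambDisc D '' s) := by
  have hO : IsOpen (D.i '' s) := D.isOpenEmbedding_i.isOpenMap _ hs
  obtain ⟨V, hV, hVO⟩ := isOpen_induced_iff.1 hO
  have key : hg.ambDisc D '' s = V ∩ {z | g z < 0} := by
    ext z
    constructor
    · rintro ⟨v, hv, rfl⟩
      refine ⟨?_, hg.apply_ambDisc_lt D v⟩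
      exact (Set.ext_iff.1 hVO (D.i v)).2 (mem_image_of_mem _ hv)
    · rintro ⟨hzV, hz⟩
      have hw : RegularSublevel.mk hg.isRegularLevel z hz.le ∈ D.i '' s :=
        (Set.ext_iff.1 hVO (RegularSublevel.mk hg.isRegularLevel z hz.le)).1 hzV
      obtain ⟨v, hv, hvz⟩ := hw
      exact ⟨v, hv, by rw [ambDisc_apply, hvz, RegularSublevel.incl_mk]⟩
  rw [key]
  exact hV.inter hg.isOpen_neg

/-- **The seam sphere `ι(Sᵐ)` is a strong deformation retract of the complement `C₁ = Sᵐ⁺¹ ∖ ι(B)`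
of the removed open ball, punctured at a point `q'` of the other open side `{g > 0}`**: `C₁` is a
smoothly embedded closed ball with boundary `ι(Sᵐ)` (Palais, `hasComplementBall_of_isSmoothEmbedding`),
`q'` an interior point of it, and §1 applies. [cite: Palais1960, Thm. B] [cite: HatcherAT2002, Ch. 0, p. 2] -/
theorem isStrongDeformationRetractOf_seam {q' : 𝕊 (m + 1)} (hq' : 0 < g q') :
    IsStrongDeformationRetractOf (hg.ambDisc D '' sphere 0 1)
      ((hg.ambDisc D '' ball 0 1)ᶜ \ {q'}) := by
  obtain ⟨U, cP, hcol, hcl⟩ := hasComplementBall_of_isSmoothEmbedding (V := 𝔼 (m + 1 + 1))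
    (n := m + 1) (hg.isSmoothEmbedding_ambDisc D)
  set e' : 𝔼 (m + 1) → 𝕊 (m + 1) := fun y => (cP y : 𝕊 (m + 1)) with he'
  have he'e : Topology.IsEmbedding e' :=
    Topology.IsEmbedding.subtypeVal.comp cP.toHomeomorph.isEmbedding
  have hcl' : e' '' closedBall 0 1 = (hg.ambDisc D '' ball 0 1)ᶜ := hcl
  have hq'C : q' ∈ (hg.ambDisc D '' ball (0 : 𝔼 (m + 1)) 1)ᶜ := by
    rintro ⟨v, -, hv⟩
    have := hg.apply_ambDisc_lt D v
    rw [hv] at this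
    exact lt_asymm this hq'
  rw [← hcl'] at hq'C
  obtain ⟨p₀, hp₀, hp₀q⟩ := hq'C
  have hp₀1 : ‖p₀‖ < 1 := by
    refine lt_of_le_of_ne (mem_closedBall_zero_iff.1 hp₀) fun h => ?_
    have h1 : e' p₀ = hg.ambDisc D p₀ := hcol p₀ h
    have := hg.apply_ambDisc_lt D p₀
    rw [← h1, hp₀q] at this
    exact lt_asymm this hq'
  have h := (PuncturedBall.isStrongDeformationRetractOf_sphere hp₀1).image_of_isEmbedding he'e
  have e1 : e' '' sphere 0 1 = hg.ambDisc D '' sphere 0 1 :=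
    image_congr fun y hy => hcol y (mem_sphere_zero_iff_norm.1 hy)
  have e2 : e' '' (closedBall 0 1 \ {p₀}) = (hg.ambDisc D '' ball 0 1)ᶜ \ {q'} := by
    rw [image_sdiff he'e.injective, hcl', image_singleton, hp₀q]
  rw [e1, e2] at h
  exact h

/-- **`W ∖ ι(B)` is a strong deformation retract of `Sᵐ⁺¹ ∖ ι(B)` punctured at a point `q'` of the
other open side**: paste the deformation of the other closed side `{g ≥ 0}` punctured at `q'` onto
its boundary `Z` (§4 for `-g`) with the identity of `W ∖ ι(B)`
(`IsStrongDeformationRetractOf.union_of_inter_subset`). [cite: HatcherAT2002, Ch. 0, p. 2] -/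
theorem isStrongDeformationRetractOf_complBall {q' : 𝕊 (m + 1)} (hq' : 0 < g q') :
    IsStrongDeformationRetractOf ({z | g z ≤ 0} \ hg.ambDisc D '' ball 0 1)
      ((hg.ambDisc D '' ball 0 1)ᶜ \ {q'}) := by
  have hneg : (fun z => -g z) q' < 0 := by simpa using hq'
  have h0 := hg.neg.isStrongDeformationRetractOf_diff_singleton hneg
  have h0' : IsStrongDeformationRetractOf Z ({z | 0 ≤ g z} \ {q'}) := by
    have hC : {z : 𝕊 (m + 1) | (fun z => -g z) z ≤ 0} = {z | 0 ≤ g z} := by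
      ext z; simp
    rw [hC] at h0
    exact h0
  have hZ := hg.mem_iff_eq_zero
  have hBneg : ∀ z ∈ hg.ambDisc D '' ball (0 : 𝔼 (m + 1)) 1, g z < 0 := by
    rintro _ ⟨v, -, rfl⟩; exact hg.apply_ambDisc_lt D v
  have hPcl : IsClosed ({z | g z ≤ 0} \ hg.ambDisc D '' ball (0 : 𝔼 (m + 1)) 1) :=
    (isClosed_le hg.continuous continuous_const).sdiff (hg.isOpen_image_ambDisc D isOpen_ball)
  have h1 := h0'.union_of_inter_subset (P := {z | g z ≤ 0} \ hg.ambDisc D '' ball 0 1)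
    (fun z hz => (hZ z).2 (le_antisymm hz.1.1 hz.2.1))
    (fun z hz => ⟨le_of_eq ((hZ z).1 hz.1), fun hB => by
      have := hBneg z hB
      rw [(hZ z).1 hz.1] at this
      exact lt_irrefl _ this⟩)
    (by rw [hPcl.closure_eq]; exact inter_subset_left)
    (fun z hz => by
      have h0le : 0 ≤ g z :=
        (isClosed_le continuous_const hg.continuous).closure_subset_iff.2 sdiff_subset hz.1
      have hz0 : g z = 0 := le_antisymm hz.2.1 h0le
      exact ⟨h0le, fun h => by rw [mem_singleton_iff.1 h] at hz0; exact hq'.ne' hz0⟩)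
  have h2 : ({z | g z ≤ 0} \ hg.ambDisc D '' ball 0 1) ∪ ({z | 0 ≤ g z} \ {q'}) =
      (hg.ambDisc D '' ball (0 : 𝔼 (m + 1)) 1)ᶜ \ {q'} := by
    ext z
    constructor
    · rintro (hz | hz)
      · refine ⟨hz.2, fun h => ?_⟩
        rw [mem_singleton_iff.1 h] at hz
        exact absurd hz.1 hq'.not_ge
      · exact ⟨fun hB => absurd hz.1 (hBneg z hB).not_ge, hz.2⟩
    · rintro ⟨hzB, hzq⟩
      rcases le_total (g z) 0 with h | h
      · exact Or.inl ⟨h, hzB⟩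
      · exact Or.inr ⟨h, hzq⟩
  rw [h2] at h1
  exact h1

/-- The seam sphere lies in `W ∖ ι(B)`. [folklore] -/
theorem sphere_subset :
    hg.ambDisc D '' sphere 0 1 ⊆ {z | g z ≤ 0} \ hg.ambDisc D '' ball 0 1 := by
  rintro _ ⟨u, hu, rfl⟩
  refine ⟨(hg.apply_ambDisc_lt D u).le, ?_⟩
  rintro ⟨v, hv, hvu⟩
  have := hg.injective_ambDisc D hvu
  subst this
  rw [mem_sphere_zero_iff_norm] at hu
  rw [mem_ball_zero_iff, hu] at hv
  exact lt_irrefl _ hv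

/-- **The inclusion `ι(Sᵐ) ↪ W ∖ ι(B)` is a homotopy equivalence** (in `Sᵐ⁺¹`): both include as
strong deformation retracts into `Sᵐ⁺¹ ∖ ι(B)` punctured at a point of the other open side; two out
of three. [cite: HatcherAT2002, Ch. 0, Cor. 0.21] -/
theorem isHomotopyEquiv_inclusion_seam : IsHomotopyEquiv (Set.inclusion (hg.sphere_subset D)) := by
  obtain ⟨q', hq'⟩ := hg.isConnected_pos.nonempty
  have hPC : {z | g z ≤ 0} \ hg.ambDisc D '' ball 0 1 ⊆ (hg.ambDisc D '' ball (0 : 𝔼 (m + 1)) 1)ᶜ \ {q'} :=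
    fun z hz => ⟨hz.2, fun h => by
      rw [mem_singleton_iff.1 h] at hz; exact absurd (show g q' ≤ 0 from hz.1) (not_le.2 hq')⟩
  have hSC : hg.ambDisc D '' sphere 0 1 ⊆ (hg.ambDisc D '' ball (0 : 𝔼 (m + 1)) 1)ᶜ \ {q'} :=
    (hg.sphere_subset D).trans hPC
  have hA := (hg.isStrongDeformationRetractOf_seam D hq').isHomotopyEquiv_inclusion hSC
  have hB := (hg.isStrongDeformationRetractOf_complBall D hq').isHomotopyEquiv_inclusion hPC
  have hcomp : Set.inclusion hPC ∘ Set.inclusion (hg.sphere_subset D) = Set.inclusion hSC := rfl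
  refine IsHomotopyEquiv.of_comp (continuous_inclusion _) hB ?_
  rw [hcomp]
  exact hA

/-- **The seam end `Sᵐ → K` of the ball-removal cobordism of a closed side is a homotopy
equivalence**: composed with the comparison map `K → W ∖ {i 0}` it is `u ↦ i u`, the composite of
the homeomorphism `Sᵐ ≅ i(Sᵐ)`, the inclusion `i(Sᵐ) ↪ W ∖ i(B)` (a homotopy equivalence by the
ambient computation `isHomotopyEquiv_inclusion_seam`, transported along `W ↪ Sᵐ⁺¹`) and the
inclusion `W ∖ i(B) ↪ W ∖ {i 0}` (radial deformation, `ComplBall.homotopyEquiv`); two out of three.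
This is the half "hence `Sⁿ` is a deformation retract of `W`" of Kervaire–Milnor's Lemma 2.3
(p. 506), here without excision or Whitehead's theorem.
[cite: KervaireMilnorAnnals1963, Lemma 2.3, proof (p. 506)] [cite: MilnorHCobordism1965, §9, proof of Prop. A (p. 109; PDF p. 58)] -/
theorem isHomotopyEquiv_cobInr : IsHomotopyEquiv (D.cobInr hg.sideCob) := by
  have hreg := hg.isRegularLevel
  -- the three subsets of `W`
  have hSK : D.i '' sphere (0 : 𝔼 (m + 1)) 1 ⊆ (D.i '' ball (0 : 𝔼 (m + 1)) 1)ᶜ := by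
    rintro _ ⟨u, hu, rfl⟩ ⟨v, hv, hvu⟩
    have := D.injective_i hvu
    subst this
    rw [mem_sphere_zero_iff_norm] at hu
    rw [mem_ball_zero_iff, hu] at hv
    exact lt_irrefl _ hv
  have hKP : (D.i '' ball (0 : 𝔼 (m + 1)) 1)ᶜ ⊆ ({D.i 0}ᶜ : Set hg.sideCob.W) := fun w hw h =>
    hw ⟨0, mem_ball_self one_pos, (show w = D.i 0 from h).symm⟩
  -- (1) `W ∖ i(B) ↪ W ∖ {i 0}` is a homotopy equivalence (radial deformation)
  have h1 : IsHomotopyEquiv (Set.inclusion hKP) := ⟨ComplBall.homotopyEquiv D.isOpenEmbedding_i, rfl⟩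
  -- (2) `i(Sᵐ) ↪ W ∖ i(B)` is a homotopy equivalence, transported from the sphere
  have hemb := RegularSublevel.isEmbedding_incl hreg
  have eS : RegularSublevel.incl hreg '' (D.i '' sphere (0 : 𝔼 (m + 1)) 1) =
      hg.ambDisc D '' sphere 0 1 := by
    rw [image_image]; rfl
  have eK : RegularSublevel.incl hreg '' (D.i '' ball (0 : 𝔼 (m + 1)) 1)ᶜ =
      {z | g z ≤ 0} \ hg.ambDisc D '' ball 0 1 := by
    ext z
    constructor
    · rintro ⟨w, hw, rfl⟩
      refine ⟨RegularSublevel.apply_incl_le hreg w, ?_⟩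
      rintro ⟨v, hv, hvw⟩
      exact hw ⟨v, hv, RegularSublevel.injective_incl hreg hvw⟩
    · rintro ⟨hz, hzB⟩
      refine ⟨RegularSublevel.mk hreg z hz, fun ⟨v, hv, hvw⟩ => hzB ⟨v, hv, ?_⟩,
        RegularSublevel.incl_mk hreg z hz⟩
      rw [ambDisc_apply, hvw, RegularSublevel.incl_mk]
  let φS : ↥(D.i '' sphere (0 : 𝔼 (m + 1)) 1) ≃ₜ ↥(hg.ambDisc D '' sphere 0 1) :=
    (embImageHomeomorph hemb _).trans (Homeomorph.setCongr eS)
  let φK : ↥((D.i '' ball (0 : 𝔼 (m + 1)) 1)ᶜ) ≃ₜ ↥({z | g z ≤ 0} \ hg.ambDisc D '' ball 0 1) :=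
    (embImageHomeomorph hemb _).trans (Homeomorph.setCongr eK)
  have hcomm : (φK : _ → _) ∘ Set.inclusion hSK = Set.inclusion (hg.sphere_subset D) ∘ φS := by
    funext x
    rfl
  have h2 : IsHomotopyEquiv (Set.inclusion hSK) := by
    apply IsHomotopyEquiv.of_homeomorph_comp φK
    rw [hcomm]
    exact (hg.isHomotopyEquiv_inclusion_seam D).comp_homeomorph φS
  -- (3) `Sᵐ ≅ i(Sᵐ)`
  have hrange : range (D.i ∘ (Subtype.val : (𝕊 m) → 𝔼 (m + 1))) = D.i '' sphere 0 1 := by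
    rw [range_comp, Subtype.range_coe]
  let σ : (𝕊 m) ≃ₜ ↥(D.i '' sphere (0 : 𝔼 (m + 1)) 1) :=
    (D.isOpenEmbedding_i.isEmbedding.comp Topology.IsEmbedding.subtypeVal).toHomeomorph.trans
      (Homeomorph.setCongr hrange)
  -- (4) the composite is the comparison map after the seam end
  have hcomp : (D.toComplCenter hg.sideCob) ∘ (D.cobInr hg.sideCob) =
      Set.inclusion hKP ∘ Set.inclusion hSK ∘ σ := by
    funext u
    apply Subtype.ext
    rw [comp_apply, BallRemovalData.coe_toComplCenter, BallRemovalData.coe_homeomorph_cobInr]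
    rfl
  refine IsHomotopyEquiv.of_comp (D.isSmoothEmbedding_cobInr hg.sideCob).isEmbedding.continuous
    (hg.isHomotopyEquiv_toComplCenter D) ?_
  rw [hcomp]
  exact (h1.comp h2).comp_homeomorph σ

/-! ### §7 The ball-removal cobordism of a closed side is a simply connected h-cobordism -/

/-- **The cobordism `(K; ∂W, Sᵐ)` obtained from a closed side `W` of a smoothly embedded
`Sᵐ ⊆ Sᵐ⁺¹` by removing an open ball is an h-cobordism** — Milnor's "`(W - Int D₀; Bd D₀, V)`
satisfies the conditions of the h-Cobordism Theorem" (proof of Prop. A, p. 109) for the `D₀ = W` of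
the proof of Prop. D (p. 112), proved here by §§4–6. [cite: MilnorHCobordism1965, §9, proof of Prop. A (p. 109; PDF p. 58) and Prop. D (p. 112; PDF p. 59)] -/
theorem isHCobordism_ballRemoval : (D.cobordism hg.sideCob).IsHCobordism :=
  ⟨hg.isHomotopyEquiv_cobInl D, hg.isHomotopyEquiv_cobInr D⟩

/-- **The ball complement `K ≅ W ∖ i(B)` of a closed side is simply connected** (`m + 1 ≥ 3`; the
side is contractible by Brown's theorem and the removed disc has codimension `≥ 3`,
`BallRemovalData.simplyConnectedSpace_K`). [cite: KervaireMilnorAnnals1963, Lemma 2.3, proof (p. 506)] -/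
theorem simplyConnectedSpace_ballRemoval_K (hm : 2 ≤ m) : SimplyConnectedSpace D.K := by
  haveI : ContractibleSpace hg.sideCob.W := hg.contractibleSpace_regularSublevel
  exact D.simplyConnectedSpace_K hg.sideCob hm

end SphereHypersurfaceSides.IsSidePackage

end Literature.Topology.FourManifolds

end
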